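import Summits.NavierStokesRegularity.NavierStokesRegularity.Theses.AxisymmetricExtremality
import Summits.NavierStokesRegularity.NavierStokesRegularity.Theorems.AxisymmetricExtremalityAxisymmetricKatoGlobalStubSeregin2020TypeIILemma22AcrossAxisIntegrands
import HarnessLib

/-!
# Seregin 2020, Lemma 2.2 (after Nazarov–Uraltseva 2012): the layer terms of the axis cut-off
# tend to zero at the regular part of the axis

Helper toward the stub `stub_seregin2020TypeII` of the crux `AxisymmetricKatoGlobal` (= the named
fact `Literature.Analysis.FluidPDE.Seregin2020_axisymmetricSingularPoint_typeII`, G. Seregin,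
Anal. Math. Phys. 10 (2020) Paper 46 = arXiv:2006.04140, Thm 2.1; remaining ingredient:
Lemma 2.2). The energy inequality off the axis (sibling `…Lemma22EnergyInequality`) is passed to
cut-offs meeting the REGULAR part of the axis (sibling `…Lemma22AcrossAxis`) by inserting
Seregin's axis cut-off `φ_ε` (`= 0` for `ϱ ≤ ε/2`, `= 1` for `ϱ ≥ ε`, `|∇φ_ε| ≤ C/ε`,
`Seregin2020.axisCutoff_props`) and letting `ε → 0`. Writing `Θ_ε = Θφ_ε`, the slice integrands
split as `f_ε = φ_ε² f + ℓ_ε` with three LAYER terms `ℓ_ε` supported in `{ε/2 ≤ ϱ ≤ ε}`: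
`-ηΘ²H'(Φ)⟪∇Φ, ∇φ_ε²⟫` (`O(ε⁻¹)` on a set of measure `O(ε²)`), `ηΘ²H(Φ)⟪U, ∇φ_ε²⟫`
(`|U|/ε ≤ |U|³ + ε^{-3/2}` and the absolute continuity of `∬|U|³`), and the axis term
`ηΘ²(2/ϱ)H(Φ)∂_ϱφ_ε²` (`O(ε⁻²)·O(ε²)·sup_{layer} H(Φ) → 0` by the continuity of `Φ` up to the
regular axis, where `Φ ≥ k` and `H = 0` on `[k,∞)` — Nazarov–Uraltseva's Remark 9: the drift
`2x'/|x'|²` has `div = 4πδ_{axis}` of the wrong sign, (4.3), so the test functions must vanish on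
the axis). This file proves that their space–time integral tends to `0`:

* `div_le_pow_three_add` — `u/ε ≤ u³ + 1/(ε√ε)`;
* `tendsto_integral_axisLayer_zero` — `∬_{(t₁,t]×ℝ³} ℓ_{εₙ} → 0` for `εₙ → 0⁺`.

## References

* G. Seregin, Anal. Math. Phys. 10 (2020), Paper 46 = arXiv:2006.04140, Lemma 2.2 and (2.13)
  (arXiv p. 8). [Seregin2020]
* A. I. Nazarov, N. N. Uraltseva, St. Petersburg Math. J. 23 (2012) 93–115 = arXiv:1011.1888,
  §3 (3.9), §4 Remark 9, Lemma 4.2, (4.3)–(4.5). [NazarovUraltseva2012]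
-/

-- the problem directory repeats the summit name (D-0017); core's `dupNamespace` linter fires
set_option linter.dupNamespace false

noncomputable section

open MeasureTheory Set Function Filter Topology TopologicalSpace Metric WithLp intervalIntegral
open scoped NNReal ENNReal InnerProductSpace RealInnerProductSpace

namespace Summit.NavierStokesRegularity.NavierStokesRegularity.Theorems.AxisymmetricKatoGlobal.EulerScaling

open Literature.Analysis.FluidPDE Literature.Analysis.FluidPDE.Seregin2020

/-! ### An elementary inequality -/

/-- `u/ε ≤ u³ + 1/(ε√ε)` for `u ≥ 0`, `ε > 0` (split at `u√ε = 1`): the factor `1/ε` of the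
cut-off gradient against the drift is paid by `∬|U|³` plus a power of `ε`. [folklore] -/
theorem div_le_pow_three_add {u ε : ℝ} (hu : 0 ≤ u) (hε : 0 < ε) :
    u / ε ≤ u ^ 3 + 1 / (ε * Real.sqrt ε) := by
  have hs : 0 < Real.sqrt ε := Real.sqrt_pos.2 hε
  have hs2 : Real.sqrt ε ^ 2 = ε := Real.sq_sqrt hε.le
  rcases le_or_gt 1 (u * Real.sqrt ε) with h | h
  · have h2 : 1 ≤ (u * Real.sqrt ε) ^ 2 := one_le_pow₀ h
    have h3 : u / ε ≤ u ^ 3 := by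
      rw [div_le_iff₀ hε]
      calc u = u * 1 := (mul_one u).symm
        _ ≤ u * (u * Real.sqrt ε) ^ 2 := mul_le_mul_of_nonneg_left h2 hu
        _ = u ^ 3 * Real.sqrt ε ^ 2 := by ring
        _ = u ^ 3 * ε := by rw [hs2]
    have h4 : 0 ≤ 1 / (ε * Real.sqrt ε) := by positivity
    linarith
  · have h3 : u / ε ≤ 1 / (ε * Real.sqrt ε) := by
      rw [div_le_div_iff₀ hε (by positivity)]
      nlinarith
    have h4 : 0 ≤ u ^ 3 := by positivity
    linarith

/-! ### The layer terms of the axis cut-off tend to zero -/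

/-- **The layer terms of the axis cut-off tend to zero** (Seregin 2020, proof of Lemma 2.2 via
Nazarov–Uraltseva 2012, Remark 9 and (4.3)–(4.5): the cut-off of the axis is removed using the
continuity of `Φ` up to the regular axis points, where `Φ ≥ k`). Setting: `Φ`, `∇Φ` continuous on
the slab `]lo,hi[ × O`, `∬_{slab}|U|³ < ∞`, `Φ ≥ k` at the axis points of the slab, `H ∈ C²` with
`H = 0` on `[k,∞)`, `Θ ∈ C¹_c`, `tsupport Θ ⊆ O`, `η` continuous, `εₙ → 0⁺` and
`φₙ = smoothTransition((2/εₙ)ϱ - 1)`. Then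
`∬_{(t₁,t]×ℝ³} ηΘ²(-H'(Φ)⟪∇Φ,∇φₙ²⟫ + H(Φ)⟪U,∇φₙ²⟫ + (2/ϱ)H(Φ)∂_ϱφₙ²) → 0`.
[cite: NazarovUraltseva2012, §4 Remark 9 and (4.3)–(4.5)] -/
theorem tendsto_integral_axisLayer_zero {O : Set (EuclideanSpace ℝ (Fin 3))} {lo hi t₁ t : ℝ}
    (h1 : lo < t₁) (h1t : t₁ ≤ t) (ht : t < hi)
    {Φ : ℝ → EuclideanSpace ℝ (Fin 3) → ℝ} {U : ℝ → EuclideanSpace ℝ (Fin 3) → EuclideanSpace ℝ (Fin 3)}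
    (hΦc : ContinuousOn (uncurry Φ) (Ioo lo hi ×ˢ O))
    (hΦg : ContinuousOn (fun z : ℝ × EuclideanSpace ℝ (Fin 3) => fderiv ℝ (Φ z.1) z.2) (Ioo lo hi ×ˢ O))
    (hU3 : ∫⁻ z in Ioo lo hi ×ˢ O, ‖U z.1 z.2‖ₑ ^ (3 : ℕ) < ⊤)
    {k : ℝ} (hk : ∀ z ∈ Ioo lo hi ×ˢ O, cylRadius z.2 = 0 → k ≤ Φ z.1 z.2)
    {H : ℝ → ℝ} (hH : ContDiff ℝ 2 H) (hHk : ∀ v, k ≤ v → H v = 0)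
    {Θ : EuclideanSpace ℝ (Fin 3) → ℝ} (hΘ : ContDiff ℝ 1 Θ) (hΘc : HasCompactSupport Θ) (hΘO : tsupport Θ ⊆ O)
    {η : ℝ → ℝ} (hη : Continuous η)
    {ε : ℕ → ℝ} (hε0 : ∀ n, 0 < ε n) (hεt : Tendsto ε atTop (𝓝 0))
    {CT : ℝ} (hCT : ∀ r, |deriv Real.smoothTransition r| ≤ CT)
    {φ : ℕ → EuclideanSpace ℝ (Fin 3) → ℝ} (hφ : ∀ n x, φ n x = Real.smoothTransition (2 / ε n * cylRadius x - 1)) :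
    Tendsto (fun n => ∫ z, η z.1 * Θ z.2 ^ 2 *
        (-(deriv H (Φ z.1 z.2) * ⟪gradient (Φ z.1) z.2, gradient (fun y => φ n y ^ 2) z.2⟫) +
          H (Φ z.1 z.2) * ⟪U z.1 z.2, gradient (fun y => φ n y ^ 2) z.2⟫ +
          2 / cylRadius z.2 * (H (Φ z.1 z.2) * fderiv ℝ (fun y => φ n y ^ 2) z.2 (eR z.2)))
        ∂((volume.restrict (Ioc t₁ t)).prod volume)) atTop (𝓝 0) := by
  set μ : Measure (ℝ × EuclideanSpace ℝ (Fin 3)) := (volume.restrict (Ioc t₁ t)).prod volume with hμ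
  obtain ⟨ℓ, hℓ⟩ : ∃ ℓ : ℕ → ℝ × EuclideanSpace ℝ (Fin 3) → ℝ, ∀ n z, ℓ n z = η z.1 * Θ z.2 ^ 2 *
      (-(deriv H (Φ z.1 z.2) * ⟪gradient (Φ z.1) z.2, gradient (fun y => φ n y ^ 2) z.2⟫) +
        H (Φ z.1 z.2) * ⟪U z.1 z.2, gradient (fun y => φ n y ^ 2) z.2⟫ +
        2 / cylRadius z.2 * (H (Φ z.1 z.2) * fderiv ℝ (fun y => φ n y ^ 2) z.2 (eR z.2))) := ⟨_, fun _ _ => rfl⟩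
  set K : Set (EuclideanSpace ℝ (Fin 3)) := tsupport Θ with hKdef
  have hK : IsCompact K := hΘc
  have hΘ0 : ∀ x, x ∉ K → Θ x = 0 := fun x hx => image_eq_zero_of_notMem_tsupport hx
  have hIcc : Icc t₁ t ⊆ Ioo lo hi := fun r hr => ⟨h1.trans_le hr.1, hr.2.trans_lt ht⟩
  have hsubK : Icc t₁ t ×ˢ K ⊆ Ioo lo hi ×ˢ O := prod_mono hIcc hΘO
  obtain ⟨R, hR0, hKR⟩ : ∃ R, 0 ≤ R ∧ K ⊆ closedBall (0 : EuclideanSpace ℝ (Fin 3)) R := by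
    obtain ⟨R, hR⟩ := hK.isBounded.subset_closedBall (0 : EuclideanSpace ℝ (Fin 3))
    exact ⟨max R 0, le_max_right _ _, hR.trans (closedBall_subset_closedBall (le_max_left _ _))⟩
  have hH' : ContDiff ℝ 1 (deriv H) := by
    have h2' : ContDiff ℝ (1 + 1) H := by rw [one_add_one_eq_two]; exact hH
    exact h2'.deriv'
  have hφP := fun n => axisCutoff_sq_props (hε0 n) hCT (hφ n)
  have hCT0 : 0 ≤ CT := (abs_nonneg _).trans (hCT 0)
  -- bounds on `[t₁, t] × K`
  obtain ⟨Cη, hCη0, hCη⟩ : ∃ C, 0 ≤ C ∧ ∀ s ∈ Icc t₁ t, |η s| ≤ C := by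
    obtain ⟨C, hC⟩ := isCompact_Icc.exists_bound_of_continuousOn (hη.continuousOn (s := Icc t₁ t))
    exact ⟨max C 0, le_max_right _ _, fun s hs => ((Real.norm_eq_abs _).symm.le.trans (hC s hs)).trans (le_max_left _ _)⟩
  obtain ⟨CΘ, hCΘ0, hCΘ⟩ : ∃ C, 0 ≤ C ∧ ∀ x, |Θ x| ≤ C := by
    obtain ⟨C, hC⟩ := hΘ.continuous.bounded_above_of_compact_support hΘc
    exact ⟨max C 0, le_max_right _ _, fun x => ((Real.norm_eq_abs _).symm.le.trans (hC x)).trans (le_max_left _ _)⟩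
  have cHΦ : ContinuousOn (fun z : ℝ × EuclideanSpace ℝ (Fin 3) => H (Φ z.1 z.2)) (Icc t₁ t ×ˢ K) :=
    (hH.continuous.comp_continuousOn hΦc).mono hsubK
  obtain ⟨CH, hCH0, hCH⟩ : ∃ C, 0 ≤ C ∧ ∀ z ∈ Icc t₁ t ×ˢ K, |H (Φ z.1 z.2)| ≤ C := by
    obtain ⟨C, hC⟩ := (isCompact_Icc.prod hK).exists_bound_of_continuousOn cHΦ
    exact ⟨max C 0, le_max_right _ _, fun z hz => ((Real.norm_eq_abs _).symm.le.trans (hC z hz)).trans (le_max_left _ _)⟩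
  obtain ⟨CH', hCH'0, hCH'⟩ : ∃ C, 0 ≤ C ∧ ∀ z ∈ Icc t₁ t ×ˢ K, |deriv H (Φ z.1 z.2)| ≤ C := by
    obtain ⟨C, hC⟩ := (isCompact_Icc.prod hK).exists_bound_of_continuousOn
      ((hH'.continuous.comp_continuousOn hΦc).mono hsubK)
    exact ⟨max C 0, le_max_right _ _, fun z hz => ((Real.norm_eq_abs _).symm.le.trans (hC z hz)).trans (le_max_left _ _)⟩
  obtain ⟨CG, hCG0, hCG⟩ : ∃ C, 0 ≤ C ∧ ∀ z ∈ Icc t₁ t ×ˢ K, ‖gradient (Φ z.1) z.2‖ ≤ C := by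
    obtain ⟨C, hC⟩ := (isCompact_Icc.prod hK).exists_bound_of_continuousOn
      (((InnerProductSpace.toDual ℝ (EuclideanSpace ℝ (Fin 3))).symm.continuous.comp_continuousOn hΦg).mono hsubK)
    exact ⟨max C 0, le_max_right _ _, fun z hz => (hC z hz).trans (le_max_left _ _)⟩
  -- `H(Φ) = 0` at the axis points of `[t₁, t] × K`
  have hHΦ0 : ∀ z ∈ Icc t₁ t ×ˢ K, cylRadius z.2 = 0 → H (Φ z.1 z.2) = 0 :=
    fun z hz hρ => hHk _ (hk z (hsubK hz) hρ)
  -- the tubes `{ϱ ≤ εₙ} ∩ K` and the drift integral over them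
  set A : ℕ → Set (EuclideanSpace ℝ (Fin 3)) := fun n => {x | cylRadius x ≤ ε n} ∩ K with hA
  have hAm : ∀ n, MeasurableSet (univ ×ˢ A n : Set (ℝ × EuclideanSpace ℝ (Fin 3))) := fun n =>
    MeasurableSet.univ.prod ((isClosed_le continuous_cylRadius continuous_const).measurableSet.inter hK.measurableSet)
  have hμA : ∀ n, μ (univ ×ˢ A n) ≤ ENNReal.ofReal ((t - t₁) * (8 * ε n ^ 2 * R)) := fun n =>
    prod_volume_tube_le hR0 hKR h1t (hε0 n).le
  have hμAt : Tendsto (fun n => μ (univ ×ˢ A n)) atTop (𝓝 0) := by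
    have hlim : Tendsto (fun n => ENNReal.ofReal ((t - t₁) * (8 * ε n ^ 2 * R))) atTop (𝓝 0) := by
      have hreal : Tendsto (fun n => (t - t₁) * (8 * ε n ^ 2 * R)) atTop (𝓝 0) := by
        have := (((hεt.pow 2).const_mul 8).mul_const R).const_mul (t - t₁)
        simpa using this
      simpa using ENNReal.tendsto_ofReal hreal
    exact tendsto_of_tendsto_of_tendsto_of_le_of_le tendsto_const_nhds hlim (fun n => zero_le) hμA
  set I : ℕ → ℝ≥0∞ := fun n => ∫⁻ z in univ ×ˢ A n, ‖U z.1 z.2‖ₑ ^ (3 : ℕ) ∂μ with hI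
  have hIt : Tendsto I atTop (𝓝 0) := by
    have hKm : MeasurableSet (univ ×ˢ K : Set (ℝ × EuclideanSpace ℝ (Fin 3))) := MeasurableSet.univ.prod hK.measurableSet
    set G : ℝ × EuclideanSpace ℝ (Fin 3) → ℝ≥0∞ := (univ ×ˢ K).indicator fun z => ‖U z.1 z.2‖ₑ ^ (3 : ℕ) with hG
    have hGfin : ∫⁻ z, G z ∂μ ≠ ⊤ := by
      have hrestr : μ.restrict (univ ×ˢ K) = volume.restrict (Ioc t₁ t ×ˢ K) := by
        rw [hμ, restrict_Ioc_prod_volume_eq, Measure.restrict_restrict hKm, prod_inter_prod, univ_inter, inter_univ]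
      rw [hG, lintegral_indicator hKm, hrestr]
      exact ((lintegral_mono_set (prod_mono (Ioc_subset_Icc_self.trans hIcc) hΘO)).trans_lt hU3).ne
    have h := tendsto_setLIntegral_zero hGfin hμAt
    refine (tendsto_congr fun n => ?_).1 h
    exact setLIntegral_congr_fun (hAm n) fun z hz => indicator_of_mem (show z ∈ univ ×ˢ K from ⟨mem_univ _, hz.2.2⟩) _
  -- the constant `B = 4 C_T C_η C_Θ²` and the eventual bound for every `δ > 0`
  set B : ℝ := 4 * CT * Cη * CΘ ^ 2 with hB
  have hB0 : 0 ≤ B := mul_nonneg (mul_nonneg (mul_nonneg (by norm_num) hCT0) hCη0) (sq_nonneg _)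
  have hev : ∀ δ : ℝ, 0 < δ → ∀ᶠ n in atTop, ∫⁻ z, ‖ℓ n z‖ₑ ∂μ ≤
      ENNReal.ofReal (8 * R * (t - t₁) * B * (CH' * CG * ε n + CH * Real.sqrt (ε n) + 4 * δ)) +
        ENNReal.ofReal (B * CH) * I n := by
    intro δ hδ
    obtain ⟨ε₀, hε₀, hsmall⟩ := exists_forall_cylRadius_le_abs_lt (isCompact_Icc.prod hK) cHΦ (δ := δ)
      (fun z hz hρ => by rw [hHΦ0 z hz hρ, abs_zero]; exact hδ)
    filter_upwards [hεt.eventually_le_const hε₀] with n hn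
    obtain ⟨-, -, hφ01, -, -, hφg, hφd, hφoff⟩ := hφP n
    have hεn : 0 < ε n := hε0 n
    have hεs0 : Real.sqrt (ε n) ≠ 0 := (Real.sqrt_pos.2 hεn).ne'
    have hεn0 : ε n ≠ 0 := hεn.ne'
    set c : ℝ := B * (CH' * CG / ε n + CH / (ε n * Real.sqrt (ε n)) + 4 * δ / ε n ^ 2) with hc
    have hc0 : 0 ≤ c := by rw [hc]; positivity
    -- the pointwise bound
    have hpt : ∀ᵐ z ∂μ, ‖ℓ n z‖ₑ ≤ (univ ×ˢ A n).indicator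
        (fun z => ENNReal.ofReal c + ENNReal.ofReal (B * CH) * ‖U z.1 z.2‖ₑ ^ (3 : ℕ)) z := by
      filter_upwards [ae_fst_mem_Ioc t₁ t] with z hz
      by_cases hzK : z.2 ∈ K
      · by_cases hsh : ε n / 2 ≤ cylRadius z.2 ∧ cylRadius z.2 ≤ ε n
        · -- on the shell
          have hzA : z ∈ univ ×ˢ A n := ⟨mem_univ _, hsh.2, hzK⟩
          rw [indicator_of_mem hzA]
          have hzIK : z ∈ Icc t₁ t ×ˢ K := ⟨Ioc_subset_Icc_self hz, hzK⟩
          have hρpos : 0 < cylRadius z.2 := lt_of_lt_of_le (half_pos (hε0 n)) hsh.1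
          have b1 : |η z.1| ≤ Cη := hCη z.1 (Ioc_subset_Icc_self hz)
          have b2 : Θ z.2 ^ 2 ≤ CΘ ^ 2 := by
            rw [← sq_abs]
            exact pow_le_pow_left₀ (abs_nonneg _) (hCΘ z.2) 2
          have b3 : |H (Φ z.1 z.2)| ≤ δ := (hsmall z hzIK (hsh.2.trans hn)).le
          have b4 : |H (Φ z.1 z.2)| ≤ CH := hCH z hzIK
          have b5 : |deriv H (Φ z.1 z.2)| ≤ CH' := hCH' z hzIK
          have b6 : ‖gradient (Φ z.1) z.2‖ ≤ CG := hCG z hzIK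
          have b7 : ‖gradient (fun y => φ n y ^ 2) z.2‖ ≤ 4 * CT / ε n := hφg z.2
          have b8 : |fderiv ℝ (fun y => φ n y ^ 2) z.2 (eR z.2)| ≤ 4 * CT / ε n := hφd z.2
          have b9 : 2 / cylRadius z.2 ≤ 4 / ε n := by
            rw [div_le_div_iff₀ hρpos (hε0 n)]
            linarith [hsh.1]
          have hU : ‖U z.1 z.2‖ / ε n ≤ ‖U z.1 z.2‖ ^ 3 + 1 / (ε n * Real.sqrt (ε n)) :=
            div_le_pow_three_add (norm_nonneg _) (hε0 n)
          have T1 : |deriv H (Φ z.1 z.2) * ⟪gradient (Φ z.1) z.2, gradient (fun y => φ n y ^ 2) z.2⟫| ≤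
              CH' * (CG * (4 * CT / ε n)) := by
            rw [abs_mul]
            exact mul_le_mul b5 ((abs_real_inner_le_norm _ _).trans (mul_le_mul b6 b7 (norm_nonneg _) hCG0))
              (abs_nonneg _) hCH'0
          have T2 : |H (Φ z.1 z.2) * ⟪U z.1 z.2, gradient (fun y => φ n y ^ 2) z.2⟫| ≤
              CH * (‖U z.1 z.2‖ * (4 * CT / ε n)) := by
            rw [abs_mul]
            exact mul_le_mul b4 ((abs_real_inner_le_norm _ _).trans (mul_le_mul_of_nonneg_left b7 (norm_nonneg _)))
              (abs_nonneg _) hCH0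
          have T3 : |2 / cylRadius z.2 * (H (Φ z.1 z.2) * fderiv ℝ (fun y => φ n y ^ 2) z.2 (eR z.2))| ≤
              4 / ε n * (δ * (4 * CT / ε n)) := by
            rw [abs_mul, abs_mul, abs_of_pos (div_pos two_pos hρpos)]
            exact mul_le_mul b9 (mul_le_mul b3 b8 (abs_nonneg _) hδ.le) (by positivity) (by positivity)
          have hsum : |ℓ n z| ≤ Cη * CΘ ^ 2 * (CH' * (CG * (4 * CT / ε n)) + CH * (‖U z.1 z.2‖ * (4 * CT / ε n)) +
              4 / ε n * (δ * (4 * CT / ε n))) := by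
            rw [hℓ n z, abs_mul, abs_mul, abs_of_nonneg (sq_nonneg (Θ z.2))]
            refine mul_le_mul (mul_le_mul b1 b2 (sq_nonneg _) hCη0) ((abs_add_le _ _).trans (add_le_add
              ((abs_add_le _ _).trans (add_le_add ?_ T2)) T3)) (abs_nonneg _) (by positivity)
            rwa [abs_neg]
          have hfin : |ℓ n z| ≤ c + B * CH * ‖U z.1 z.2‖ ^ 3 := by
            have e1 : Cη * CΘ ^ 2 * (CH' * (CG * (4 * CT / ε n)) + CH * (‖U z.1 z.2‖ * (4 * CT / ε n)) +
                4 / ε n * (δ * (4 * CT / ε n))) =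
                B * (CH' * CG / ε n + 4 * δ / ε n ^ 2) + B * CH * (‖U z.1 z.2‖ / ε n) := by
              simp only [hB]
              field_simp
              ring
            have e2 : c + B * CH * ‖U z.1 z.2‖ ^ 3 =
                B * (CH' * CG / ε n + 4 * δ / ε n ^ 2) + B * CH * (‖U z.1 z.2‖ ^ 3 + 1 / (ε n * Real.sqrt (ε n))) := by
              simp only [hc]
              ring
            rw [e2]
            exact (hsum.trans_eq e1).trans (add_le_add le_rfl (mul_le_mul_of_nonneg_left hU (mul_nonneg hB0 hCH0)))
          calc ‖ℓ n z‖ₑ = ENNReal.ofReal |ℓ n z| := Real.enorm_eq_ofReal_abs _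
            _ ≤ ENNReal.ofReal (c + B * CH * ‖U z.1 z.2‖ ^ 3) := ENNReal.ofReal_le_ofReal hfin
            _ = ENNReal.ofReal c + ENNReal.ofReal (B * CH) * ‖U z.1 z.2‖ₑ ^ (3 : ℕ) := by
                rw [ENNReal.ofReal_add hc0 (by positivity), ENNReal.ofReal_mul (mul_nonneg hB0 hCH0),
                  ENNReal.ofReal_pow (norm_nonneg _), ofReal_norm]
        · -- in `K`, off the shell: the gradient of the axis cut-off vanishes
          have hoff : cylRadius z.2 < ε n / 2 ∨ ε n < cylRadius z.2 := by
            rcases not_and_or.1 hsh with h | h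
            · exact Or.inl (not_le.1 h)
            · exact Or.inr (not_le.1 h)
          obtain ⟨hg0, hd0⟩ := hφoff z.2 hoff
          have h0 : ℓ n z = 0 := by
            rw [hℓ n z, hg0, hd0]
            simp
          rw [h0, enorm_zero]
          exact zero_le
      · have h0 : ℓ n z = 0 := by
          rw [hℓ n z, hΘ0 z.2 hzK]
          simp
        rw [h0, enorm_zero]
        exact zero_le
    -- integrate the pointwise bound
    have hεs : ε n / Real.sqrt (ε n) = Real.sqrt (ε n) := Real.div_sqrt
    have e3 : c * ((t - t₁) * (8 * ε n ^ 2 * R)) = 8 * R * (t - t₁) * B * (CH' * CG * ε n + CH * Real.sqrt (ε n) + 4 * δ) := by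
      rw [← hεs]
      simp only [hc]
      field_simp
    calc ∫⁻ z, ‖ℓ n z‖ₑ ∂μ
        ≤ ∫⁻ z, (univ ×ˢ A n).indicator (fun z => ENNReal.ofReal c + ENNReal.ofReal (B * CH) * ‖U z.1 z.2‖ₑ ^ (3 : ℕ)) z ∂μ :=
          lintegral_mono_ae hpt
      _ = ENNReal.ofReal c * μ (univ ×ˢ A n) + ENNReal.ofReal (B * CH) * I n := by
          rw [lintegral_indicator (hAm n), lintegral_add_left measurable_const, setLIntegral_const,
            lintegral_const_mul' _ _ ENNReal.ofReal_ne_top]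
      _ ≤ ENNReal.ofReal c * ENNReal.ofReal ((t - t₁) * (8 * ε n ^ 2 * R)) + ENNReal.ofReal (B * CH) * I n :=
          add_le_add (mul_le_mul' le_rfl (hμA n)) le_rfl
      _ = ENNReal.ofReal (8 * R * (t - t₁) * B * (CH' * CG * ε n + CH * Real.sqrt (ε n) + 4 * δ)) +
            ENNReal.ofReal (B * CH) * I n := by
          rw [← ENNReal.ofReal_mul hc0, e3]
  -- the `limsup` of `∫⁻ |ℓₙ|` is `≤ 32 R (t - t₁) B δ` for every `δ > 0`, hence `0`
  have hw : ∀ δ : ℝ, Tendsto (fun n => ENNReal.ofReal (8 * R * (t - t₁) * B * (CH' * CG * ε n + CH * Real.sqrt (ε n) + 4 * δ)) +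
      ENNReal.ofReal (B * CH) * I n) atTop (𝓝 (ENNReal.ofReal (8 * R * (t - t₁) * B * (4 * δ)))) := by
    intro δ
    have hsq : Tendsto (fun n => Real.sqrt (ε n)) atTop (𝓝 0) := by
      simpa using hεt.sqrt
    have hreal : Tendsto (fun n => 8 * R * (t - t₁) * B * (CH' * CG * ε n + CH * Real.sqrt (ε n) + 4 * δ)) atTop
        (𝓝 (8 * R * (t - t₁) * B * (4 * δ))) := by
      have := (((hεt.const_mul (CH' * CG)).add (hsq.const_mul CH)).add_const (4 * δ)).const_mul (8 * R * (t - t₁) * B)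
      simpa using this
    have h2 : Tendsto (fun n => ENNReal.ofReal (B * CH) * I n) atTop (𝓝 0) := by
      have := ENNReal.Tendsto.const_mul hIt (Or.inr ENNReal.ofReal_ne_top) (a := ENNReal.ofReal (B * CH))
      rwa [mul_zero] at this
    simpa using (ENNReal.tendsto_ofReal hreal).add h2
  have hlim : Tendsto (fun n => ∫⁻ z, ‖ℓ n z‖ₑ ∂μ) atTop (𝓝 0) := by
    refine tendsto_of_le_liminf_of_limsup_le zero_le ?_
    refine ENNReal.le_of_forall_pos_le_add fun e he _ => ?_
    rw [zero_add]
    set δ : ℝ := (e : ℝ) / (32 * R * (t - t₁) * B + 1) with hδ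
    have hD0 : 0 ≤ 32 * R * (t - t₁) * B := by
      have : 0 ≤ t - t₁ := sub_nonneg.2 h1t
      positivity
    have hδ0 : 0 < δ := div_pos (by exact_mod_cast he) (by linarith)
    calc limsup (fun n => ∫⁻ z, ‖ℓ n z‖ₑ ∂μ) atTop
        ≤ limsup (fun n => ENNReal.ofReal (8 * R * (t - t₁) * B * (CH' * CG * ε n + CH * Real.sqrt (ε n) + 4 * δ)) +
            ENNReal.ofReal (B * CH) * I n) atTop := limsup_le_limsup (hev δ hδ0)
      _ = ENNReal.ofReal (8 * R * (t - t₁) * B * (4 * δ)) := (hw δ).limsup_eq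
      _ ≤ (e : ℝ≥0∞) := by
          rw [← ENNReal.ofReal_coe_nnreal]
          refine ENNReal.ofReal_le_ofReal ?_
          have hle : 32 * R * (t - t₁) * B * δ ≤ (e : ℝ) := by
            rw [hδ, mul_div_assoc', div_le_iff₀ (by linarith)]
            nlinarith [NNReal.coe_nonneg e]
          linarith
  -- from `∫⁻ |ℓₙ| → 0` to `∫ ℓₙ → 0`
  have hreal : Tendsto (fun n => ∫ z, ℓ n z ∂μ) atTop (𝓝 0) := by
    have h0 : Tendsto (fun n => (∫⁻ z, ‖ℓ n z‖ₑ ∂μ).toReal) atTop (𝓝 0) := by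
      have h := (ENNReal.tendsto_toReal ENNReal.zero_ne_top).comp hlim
      rw [ENNReal.toReal_zero] at h
      exact h
    refine squeeze_zero_norm (fun n => ?_) h0
    refine (norm_integral_le_lintegral_norm _).trans_eq ?_
    simp only [ofReal_norm]
  refine hreal.congr fun n => integral_congr_ae (ae_of_all _ fun z => hℓ n z)

end Summit.NavierStokesRegularity.NavierStokesRegularity.Theorems.AxisymmetricKatoGlobal.EulerScaling

end
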